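import Summits.BirchSwinnertonDyer.BirchSwinnertonDyer.Theorems.AlignedTransportAtTwoMainConjectureOfRankZeroBSDAtTwoSelmerLayerMuDoor
import Summits.BirchSwinnertonDyer.BirchSwinnertonDyer.Theorems.AlignedTransportAtTwoMainConjectureOfRankZeroBSDAtTwoSelmerLayerModel
import Literature.NumberTheory.EllipticCurves.ZpExtensionLayerNoPTorsionProofs
import Literature.NumberTheory.EllipticCurves.SelmerLayerRestrictionInjectiveProofs
import Summits.BirchSwinnertonDyer.Rank1Residual.Additive.BudgetFromRationalClasses
import HarnessLib

/-!
# Route `AlignedTransportAtTwo`, crux C2 `MainConjectureOfRankZeroBSDAtTwo` (stmt-BirchSwinnertonDyer-22298):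
# THE `μ`-DOOR IN DESCENT CURRENCY FOR EVERY PRIME AND EVERY NUMBER FIELD — g43's Selmer rank-jump door read in the
# `p`-Selmer groups `Sel^(p)(E_{K_n}/K_n)` of honest `p`-descents over the layers, whenever `E(K)[p] = 0`

HONEST FRAMING (cell `bsd-f1-sign2`, WIDTH-5 attached prover seat `bsd-line-att-p5` gen 45 on line `birth` of the lead
`bsd-line-att-p2`; `--supports` stmt-BirchSwinnertonDyer-22298, closes nothing; BSD is NOT proved by any of this; the crux C2,
its verdict «blocked-on `Rank1Residual.GreenbergMuConjectureIrreducible`» and every registered stub are untouched). THEOREMS ONLY —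
no `def`, no instance, no named fact, no `sorry`. PLACEMENT: COROLLARY-OF-TREE (g43 `isTorsion_and_mu_eq_zero_of_selmer_rankJump[_rat]`,
g39 `natCard_torsionBy_selmerLayer_eq`, this seat's Literature bricks `ZpExtensionLayerNoPTorsionProofs` (E(K_n)[p] = 0 by the Galois
fixed-point argument) and `SelmerLayerRestrictionInjectiveProofs` (monotonicity)). Lineage successor item (iii) of gen 44: g44's
descent currency used `3 ∤ [ℚ_n : ℚ]`, special to `p = 2`; here the prime and the base field are arbitrary.

* ★ `natCard_selmerGroup_layer_eq_natCard_torsionBy_selmerLayer` — **`#Sel^(p)(E_{K_n}/K_n) = #(W.selmerLayer κ n)[p]`** for every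
  number field `K`, prime `p`, `ℤ_p`-extension `κ`, layer `n`, when `E(K)[p] = 0`;
* ★ `natCard_selmerGroup_layer_mono` — **`#Sel^(p)(E/K_j) ≤ #Sel^(p)(E/K_k)`** for `j ≤ k` (descent ranks only grow, every `p`);
* ★★ `isTorsion_and_mu_eq_zero_of_descent_rankJump` — **g43's door in descent currency, any `K`, any `p`**: `E(K)[p] = 0`, `X` finitely
  generated over `Λ`, `ker g_k` finite, and ONE inequality `#Sel^(p)(E/K_k) · #ker g_k · p^{p^j} < #Sel^(p)(E/K_j) · p^{p^k}` (`j < k`) give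
  `X` torsion, `μ(X) = 0`, `X` f.g. over `ℤ_p`, `p^{λ(X)} ≤ #Sel^(p)(E/K_k) · #ker g_k`;
* ★★ `isTorsion_and_mu_eq_zero_of_descent_rankJump_rat` — over `ℚ` at ANY good ordinary `p` with `p ∤ #E(ℚ)_tors` (`κ` cyclotomic): no
  finiteness hypothesis left; `natCard_selmerGroup_layer_mono_rat`; `twoLayer_floor_allPrimes` — the floor `#ker g_k · p^{p^j} < p^{p^k}`.

References: R. Greenberg, LNM 1716 (1999), §1 Conj. 1.11, §3 Lemmas 3.1–3.4 [GreenbergLNM1716]; L. C. Washington, GTM 83, §13.3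
Prop. 13.22–13.23 [Washington1997]; J. H. Silverman, GTM 106, Thm. X.4.2 [SilvermanAEC2009].
-/

set_option linter.dupNamespace false
set_option autoImplicit false

noncomputable section

open scoped Classical AddSubgroup

namespace Summit.BirchSwinnertonDyer.BirchSwinnertonDyer.Theorems.AlignedTransportAtTwoSelmerLayerDescentAllPrimes

open WeierstrassCurve Literature.NumberTheory.EllipticCurves Literature.NumberTheory.EllipticCurves.Greenberg1999
  Summit.BirchSwinnertonDyer.BirchSwinnertonDyer.Theorems.AlignedTransportAtTwoSelmerLayerModel
  Summit.BirchSwinnertonDyer.BirchSwinnertonDyer.Theorems.AlignedTransportAtTwoSelmerLayerMuDoor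
  Summit.BirchSwinnertonDyer.BirchSwinnertonDyer.Theorems.AlignedTransportAtTwoSelmerLayerAllPrimes

universe u

section General

variable {K : Type u} [Field K] [NumberField K] (W : WeierstrassCurve K) [W.IsElliptic]
  {p : ℕ} [hp : Fact p.Prime] (κ : ZpExtension K p)

/-- ★ **`#Sel^(p)(E_{K_n}/K_n) = #(W.selmerLayer κ n)[p]`** at every layer of ANY `ℤ_p`-extension of a number field when `E(K)[p] = 0`:
the `p`-descent over the layer number field `K_n` counts exactly the `p`-torsion of `Sel_{p^∞}(E_{K_n}/K_n)` (Literature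
`natCard_selmerGroup_layer_eq_natCard_torsionBy_selmerGroupPInfty`, `E(K_n)[p] = 0` by the Galois fixed-point argument), which is the
`p`-torsion of the `Γ_K`-internal layer Selmer group (g39 `natCard_torsionBy_selmerLayer_eq`). [cite: SilvermanAEC2009, Thm. X.4.2]
[cite: GreenbergLNM1716, §3 Lemma 3.1] -/
theorem natCard_selmerGroup_layer_eq_natCard_torsionBy_selmerLayer (hK : ∀ P : W.toAffine.Point, p • P = 0 → P = 0) (n : ℕ) :
    Nat.card ((W.baseChange (κ.layer n)).selmerGroup p) = Nat.card ((↥(W.selmerLayer κ n))[(p : ℤ)]) := by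
  haveI : FiniteDimensional K (κ.layer n) := κ.finiteDimensional_layer_holds n
  haveI : NumberField (κ.layer n) := NumberField.of_module_finite K (κ.layer n)
  rw [W.natCard_selmerGroup_layer_eq_natCard_torsionBy_selmerGroupPInfty κ hK n]
  exact natCard_torsionBy_selmerLayer_eq W κ n p

/-- ★ **Descent ranks only grow, every prime: `#Sel^(p)(E/K_j) ≤ #Sel^(p)(E/K_k)` for `j ≤ k`** when `E(K)[p] = 0` (Literature
`natCard_torsionBy_selmerLayer_mono` read in descent currency). [cite: GreenbergLNM1716, §3 Lemma 3.1] [cite: SilvermanAEC2009, Thm. X.4.2] -/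
theorem natCard_selmerGroup_layer_mono (hK : ∀ P : W.toAffine.Point, p • P = 0 → P = 0) {j k : ℕ} (hjk : j ≤ k) :
    Nat.card ((W.baseChange (κ.layer j)).selmerGroup p) ≤ Nat.card ((W.baseChange (κ.layer k)).selmerGroup p) := by
  rw [natCard_selmerGroup_layer_eq_natCard_torsionBy_selmerLayer W κ hK j,
    natCard_selmerGroup_layer_eq_natCard_torsionBy_selmerLayer W κ hK k]
  exact W.natCard_torsionBy_selmerLayer_mono κ hK hjk

/-- ★★ **g43's SELMER RANK-JUMP `μ`-DOOR IN DESCENT CURRENCY — any number field, any prime, any `ℤ_p`-extension with topological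
generator `γ`, any dual datum `D` with `X` finitely generated over `Λ`.** If `E(K)[p] = 0`, `ker g_k` is finite and for ONE pair of
layers `j < k` **`#Sel^(p)(E/K_k) · #ker g_k · p^{p^j} < #Sel^(p)(E/K_j) · p^{p^k}`** (`Sel^(p)(E/K_n) = selmerGroup (W.baseChange (κ.layer n)) p`,
the `p`-Selmer group of a `p`-descent over `K_n`), then `X` is `Λ`-torsion, `μ(X) = 0`, `X` is finitely generated over `ℤ_p` and
`p^{λ(X)} ≤ #Sel^(p)(E/K_k) · #ker g_k`. [cite: GreenbergLNM1716, §1 Conj. 1.11; §3 Lemmas 3.1–3.4] [cite: Washington1997, §13.3 Prop. 13.23]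
[cite: SilvermanAEC2009, Thm. X.4.2] -/
theorem isTorsion_and_mu_eq_zero_of_descent_rankJump (hK : ∀ P : W.toAffine.Point, p • P = 0 → P = 0)
    {γ : Field.absoluteGaloisGroup K} (hγ : κ.IsTopGenerator γ) (D : W.SelmerDualData κ γ)
    [Module.Finite (IwasawaAlgebra p) D.X] {j k : ℕ} (hjk : j < k) [Finite (W.KerG κ k)]
    (hlt : Nat.card ((W.baseChange (κ.layer k)).selmerGroup p) * Nat.card (W.KerG κ k) * p ^ (p ^ j) <
      Nat.card ((W.baseChange (κ.layer j)).selmerGroup p) * p ^ (p ^ k)) :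
    D.IsTorsion ∧ D.mu = 0 ∧ Module.Finite ℤ_[p] (RestrictScalars ℤ_[p] (IwasawaAlgebra p) D.X) ∧
      p ^ D.lambda ≤ Nat.card ((W.baseChange (κ.layer k)).selmerGroup p) * Nat.card (W.KerG κ k) := by
  rw [natCard_selmerGroup_layer_eq_natCard_torsionBy_selmerLayer W κ hK k] at hlt ⊢
  rw [natCard_selmerGroup_layer_eq_natCard_torsionBy_selmerLayer W κ hK j] at hlt
  exact isTorsion_and_mu_eq_zero_of_selmer_rankJump W κ hγ D (W.fixedPoints_kerSubgroup_geomPrimaryTorsion_eq_bot κ hK) hjk hlt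

/-- **The floor of the two-layer door, every prime**: the inequality forces `#ker g_k · p^{p^j} < p^{p^k}` (descent ranks only grow).
[cite: GreenbergLNM1716, §3 Lemmas 3.1–3.4] -/
theorem twoLayer_floor_allPrimes (hK : ∀ P : W.toAffine.Point, p • P = 0 → P = 0) {j k : ℕ} (hjk : j ≤ k)
    (hlt : Nat.card ((W.baseChange (κ.layer k)).selmerGroup p) * Nat.card (W.KerG κ k) * p ^ (p ^ j) <
      Nat.card ((W.baseChange (κ.layer j)).selmerGroup p) * p ^ (p ^ k)) :
    Nat.card (W.KerG κ k) * p ^ (p ^ j) < p ^ (p ^ k) := by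
  have hmono := natCard_selmerGroup_layer_mono W κ hK hjk
  have h : Nat.card ((W.baseChange (κ.layer k)).selmerGroup p) * (Nat.card (W.KerG κ k) * p ^ (p ^ j)) <
      Nat.card ((W.baseChange (κ.layer k)).selmerGroup p) * p ^ (p ^ k) :=
    calc Nat.card ((W.baseChange (κ.layer k)).selmerGroup p) * (Nat.card (W.KerG κ k) * p ^ (p ^ j))
        = Nat.card ((W.baseChange (κ.layer k)).selmerGroup p) * Nat.card (W.KerG κ k) * p ^ (p ^ j) := by ring
      _ < Nat.card ((W.baseChange (κ.layer j)).selmerGroup p) * p ^ (p ^ k) := hlt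
      _ ≤ Nat.card ((W.baseChange (κ.layer k)).selmerGroup p) * p ^ (p ^ k) := Nat.mul_le_mul_right _ hmono
  exact Nat.lt_of_mul_lt_mul_left h

end General

section Rat

variable (W : WeierstrassCurve ℚ) [W.IsElliptic] [W.IsGloballyMinimal] {p : ℕ} [hp : Fact p.Prime]
  (κ : ZpExtension ℚ p)

/-- ★★ **The door over `ℚ` at ANY good ordinary prime `p` with `p ∤ #E(ℚ)_tors`, in descent currency** (`κ` cyclotomic with topological
generator `γ`, ANY dual datum `D`; no finite-generation / finiteness hypothesis left — g43 `isTorsion_and_mu_eq_zero_of_selmer_rankJump_rat`,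
`E(ℚ)[p] = 0` from `p ∤ #E(ℚ)_tors` by `Rank1Residual.Additive.forall_smul_eq_zero_of_not_dvd_torsionOrder`): ONE inequality
`#Sel^(p)(E/ℚ_k) · #ker g_k · p^{p^j} < #Sel^(p)(E/ℚ_j) · p^{p^k}` at layers `j < k` of the cyclotomic `ℤ_p`-tower, between the `p`-Selmer
groups of two honest `p`-descents, gives `X(E/ℚ_∞)` torsion with `μ_p = 0` and `p^{λ} ≤ #Sel^(p)(E/ℚ_k) · #ker g_k`.
[cite: GreenbergLNM1716, §1 Conj. 1.11; §3 Lemmas 3.1–3.4] [cite: Washington1997, §13.3 Prop. 13.23] [cite: SilvermanAEC2009, Thm. X.4.2] -/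
theorem isTorsion_and_mu_eq_zero_of_descent_rankJump_rat (hord : IsOrdinaryAt W p) (htors : ¬ p ∣ W.torsionOrder)
    (hκ : κ.IsCyclotomic) {γ : Field.absoluteGaloisGroup ℚ} (hγ : κ.IsTopGenerator γ) (D : W.SelmerDualData κ γ) {j k : ℕ}
    (hjk : j < k)
    (hlt : Nat.card ((W.baseChange (κ.layer k)).selmerGroup p) * Nat.card (W.KerG κ k) * p ^ (p ^ j) <
      Nat.card ((W.baseChange (κ.layer j)).selmerGroup p) * p ^ (p ^ k)) :
    D.IsTorsion ∧ D.mu = 0 ∧ Module.Finite ℤ_[p] (RestrictScalars ℤ_[p] (IwasawaAlgebra p) D.X) ∧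
      p ^ D.lambda ≤ Nat.card ((W.baseChange (κ.layer k)).selmerGroup p) * Nat.card (W.KerG κ k) := by
  -- the `ℚ`-algebra structure on `ℚ_n` elaborated here (`DivisionRing.toRatAlgebra`) and the intermediate-field one of the general
  -- statement agree definitionally (`Subsingleton (Algebra ℚ _)`); `exact` unifies them, `rw` would not (g44's caveat)
  have hK := Summit.BirchSwinnertonDyer.Rank1Residual.Additive.forall_smul_eq_zero_of_not_dvd_torsionOrder W p htors
  haveI : Module.Finite (IwasawaAlgebra p) D.X := SelmerDualData.module_finite_of_isCyclotomic W κ hκ D hγ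
  haveI : Finite (W.KerG κ k) := finite_kerG_of_isOrdinaryAt W hord hκ k
  exact isTorsion_and_mu_eq_zero_of_descent_rankJump W κ hK hγ D hjk hlt

omit [W.IsGloballyMinimal] in
/-- **Descent ranks only grow over `ℚ`, every prime `p ∤ #E(ℚ)_tors`**: `#Sel^(p)(E/ℚ_j) ≤ #Sel^(p)(E/ℚ_k)` for `j ≤ k` and any
`ℤ_p`-extension `κ` of `ℚ`. [cite: GreenbergLNM1716, §3 Lemma 3.1] [cite: SilvermanAEC2009, Thm. X.4.2] -/
theorem natCard_selmerGroup_layer_mono_rat (htors : ¬ p ∣ W.torsionOrder) {j k : ℕ} (hjk : j ≤ k) :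
    Nat.card ((W.baseChange (κ.layer j)).selmerGroup p) ≤ Nat.card ((W.baseChange (κ.layer k)).selmerGroup p) :=
  natCard_selmerGroup_layer_mono W κ
    (Summit.BirchSwinnertonDyer.Rank1Residual.Additive.forall_smul_eq_zero_of_not_dvd_torsionOrder W p htors) hjk

end Rat

end Summit.BirchSwinnertonDyer.BirchSwinnertonDyer.Theorems.AlignedTransportAtTwoSelmerLayerDescentAllPrimes

end
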